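import Literature.MathematicalPhysics.QuantumFieldTheory.ConformalBootstrap3D.PointKernelK34v2Data
import Literature.MathematicalPhysics.QuantumFieldTheory.ConformalBootstrap3D.PointKernelParts

/-!
# K34v2 certificate, kernel part file P55: one-cell head segments 160, 161 in level ranges

The head cells whose kernel evaluation exceeds one `decide` are one-cell segments of `hsegsK34v2`; each is
checked by `PCert.hPartSideOK` (side conditions) and `PCert.hPartOK` per level range `[n_lo, n_lo + count)`
against an integer claim, the claims summing to `≥ 0` (`PointKernel.partsOK`); soundness is
`PCert.hParts_sound` (`PointKernelParts`).  The part files `P1, P2, …` are mutually independent (each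
imports only the data file); the ranges of one cell may span several of them, and the per-cell
conclusions `hparts_i` / `hcell_i` of those cells are assembled in `PointKernelK34v2.lean`.
Estimated kernel time 240 s.
-/

set_option maxRecDepth 100000
set_option maxHeartbeats 0

namespace Literature.MathematicalPhysics.QuantumFieldTheory.ConformalBootstrap3D.PointKernelK34v2

open Literature.MathematicalPhysics.QuantumFieldTheory.ConformalBootstrap3D.PointKernel

/-- levels `[43, 52)` of segment 160: partial lower sum `≥` claim. [folklore] -/
theorem part_160_2 : certK34v2.hPartOK (PCert.segAt hsegsK34v2 160) JHK34v2 43 9 (4521174136688731928273279728465369195) = true := by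
  decide +kernel

/-- levels `[52, 57)` of segment 160: partial lower sum `≥` claim. [folklore] -/
theorem part_160_3 : certK34v2.hPartOK (PCert.segAt hsegsK34v2 160) JHK34v2 52 5 (958506778755080436429439751500748272) = true := by
  decide +kernel

/-- one-cell segment 161 (row 6, cell `[3591/512, 449/64]`, chord, `n_F = 64`,
6 level ranges): side conditions. [folklore] -/
theorem pside_161 : certK34v2.hPartSideOK (PCert.segAt hsegsK34v2 161) JHK34v2 = true := by
  decide +kernel

/-- its level ranges `(n_lo, count, claim)`. [folklore] -/
def parts_161 : List (ℕ × ℕ × ℤ) := [(0, 28, -32223115213394168132365008188178325129), (28, 12, 23004605317040609182131857545628650528), (40, 9, 6276111910378790587344328125152574037), (49, 7, 1980442913614878543754726449804062306), (56, 5, 673326335160364903732443564779632576), (61, 4, 288628737199524915401652502813405683)]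

/-- the ranges tile `[0, n_F]` and the claims sum to `≥ 0`. [folklore] -/
theorem pcov_161 : PointKernel.partsOK 64 parts_161 = true := by
  decide +kernel

/-- levels `[0, 28)` of segment 161: partial lower sum `≥` claim. [folklore] -/
theorem part_161_0 : certK34v2.hPartOK (PCert.segAt hsegsK34v2 161) JHK34v2 0 28 (-32223115213394168132365008188178325129) = true := by
  decide +kernel

/-- levels `[28, 40)` of segment 161: partial lower sum `≥` claim. [folklore] -/
theorem part_161_1 : certK34v2.hPartOK (PCert.segAt hsegsK34v2 161) JHK34v2 28 12 (23004605317040609182131857545628650528) = true := by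
  decide +kernel

end Literature.MathematicalPhysics.QuantumFieldTheory.ConformalBootstrap3D.PointKernelK34v2
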